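import Mathlib
import Summits.Ventures.PercRepro2.Defs
import Summits.Ventures.PercRepro2.Graph
import Summits.Ventures.PercRepro2.OneColourSwitch
import Summits.Ventures.PercRepro2.RegionHubSign
import Summits.Ventures.PercRepro2.SideSwitch
import Summits.Ventures.PercRepro2.SideSwitchClosed
import Summits.Ventures.PercRepro2.M9NoPocketDefs
import Summits.Ventures.PercRepro2.M9NoPocketWorld
import Summits.Ventures.PercRepro2.M9NoPocketWorldD
import Summits.Ventures.PercRepro2.M9NoPocketFibre
import Summits.Ventures.PercRepro2.M9SubcubeHarris
import Summits.Ventures.PercRepro2.M9ClusterFibreHarris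
import Summits.Ventures.PercRepro2.M9PocketUnitFibre
import Summits.Ventures.PercRepro2.M9PocketUnitFibreSum
import Summits.Ventures.PercRepro2.M9PocketPsi2
import Summits.Ventures.PercRepro2.M9PocketPsi2Sign
import Summits.Ventures.PercRepro2.M9PocketProdPoint

/-!
# The product fibre of a skeleton: the worlds and the legality (blind cell PercRepro2, p3 g39,
2026-08-29; `proofs/P3-POCKETRK.md` §8′ (ii)–(iv) and §10 (d): the free-block extension, part 2)

Continuation of `M9PocketProdPoint`.  The worlds of `{r, s}` in `G` at a point `φ S` of the
product fibre of the skeleton `ρ`: the `W`-world lies in `{r, s} ∪ switched`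
(`M2_prod_subset`: the root edges of the switched blocks are `W`, their attachment edges `Y`,
every other edge at `r, s` is `Y`), the `Y`-world in
`Z(S) = (K₂(G − d) ∖ switched) ∪ {d} ∪ (C_Y(d; ρ) ∖ (K₂ ∪ M₂)(G − d))` (`K2_prod_subset`: the
edges inside `Z(S)` are fixed, the root edges of the switched blocks are `W`, every edge
leaving `Z(S)` to the outside is `W` at `ρ` and fixed).  Hence **every point of the product
fibre is `Sep ∧ DOne`**: `sep2_prod`, `DOne_prod` (`d ∈ K₂ ∖ M₂` in part 3, `M9PocketProdMono`).
Own work; std axioms.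
-/

namespace Summit.Ventures.PercRepro2

namespace NoPocket

open Finset Classical OneColourSwitch SideSwitch

variable {V : Type*} {E : Type*} {ends : E → Sym2 V} {p q r s d : V} {ρ : Config E}
  {𝔉 : Finset (Finset V)} {R : Finset E}

section Worlds

variable (hdr : d ≠ r) (hds : d ≠ s) (hrs : within ends ({r, s} : Set V) = ∅)
  (hT : ∀ e, ends e ≠ s(d, r) ∧ ends e ≠ s(d, s))
  (hsep : sep2 ends p q r s ρ) (hD : DOne ends r s d ρ) (hK : d ∈ K2 ends r s ρ)
  (hB : ∀ x ∈ M2 (endsD ends d) r s ρ, x = r ∨ x = s)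
  (hR : ∀ e, e ∈ R ↔ e ∉ touches ends (cluster ends ρ d ∪ K2 (endsD ends d) r s ρ ∪
    M2 (endsD ends d) r s ρ))
  (h𝔉K : ∀ C ∈ 𝔉, (↑C : Set V) ⊆ K2 (endsD ends d) r s ρ)
  (h𝔉r : ∀ C ∈ 𝔉, r ∉ C) (h𝔉s : ∀ C ∈ 𝔉, s ∉ C)
  (h𝔉cl : ∀ C ∈ 𝔉, ClosedIn (endsD ends d) (sided (endsD ends d) r s ρ) (↑C : Set V))
  (h𝔉d : ∀ C ∈ 𝔉, ∀ e y, y ∈ C → ends e ≠ s(d, y))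
  (h𝔉pk : ∀ C ∈ 𝔉, ∀ e x y, ends e = s(x, y) → x ∈ C → y ∈ cluster ends ρ d →
    y ∈ C ∨ y = r ∨ y = s)
  (S : Finset ({C // C ∈ 𝔉} ⊕ {e // e ∈ R}))

include hdr hds hrs hT hsep hB hR h𝔉K h𝔉r h𝔉s h𝔉cl h𝔉d in
/-- **The `W`-world of `{r, s}` at `φ S` lies in `{r, s} ∪ switched`**: the root edges of the
switched blocks are `W`, their attachment edges `Y`; every other edge at `r, s` is `Y`. -/
lemma M2_prod_subset :
    M2 ends r s (flipTouch (endsD ends d)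
      {x : V | ∃ c : {C // C ∈ 𝔉}, Sum.inl c ∈ S ∧ x ∈ c.1}
      (fun e => if h : e ∈ R then decide (Sum.inr ⟨e, h⟩ ∈ S) else ρ e)) ⊆
      {x : V | x = r ∨ x = s ∨ ∃ c : {C // C ∈ 𝔉}, Sum.inl c ∈ S ∧ x ∈ c.1} := by
  set Sw := {x : V | ∃ c : {C // C ∈ 𝔉}, Sum.inl c ∈ S ∧ x ∈ c.1} with hSw
  set ω' := flipTouch (endsD ends d) Sw
    (fun e => if h : e ∈ R then decide (Sum.inr ⟨e, h⟩ ∈ S) else ρ e) with hω'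
  have hsepD := sep2_endsD_of_sep2 (d := d) hsep
  have hSwK := switched_subset_K2 (ρ := ρ) (r := r) (s := s) (d := d) (R := R) h𝔉K S
  -- an edge touching a switched vertex is not at `d`
  have hnot_d : ∀ e x y, ends e = s(x, y) → x ∈ Sw → d ∉ ends e := by
    intro e x y hxy hxSw hde
    obtain ⟨c, hcS, hx⟩ := hxSw
    have hxd : x ≠ d := fun h => not_mem_K2_endsD hdr hds ρ (h ▸ hSwK ⟨c, hcS, hx⟩)
    rw [hxy, Sym2.mem_iff] at hde
    rcases hde with h | h
    · exact hxd h.symm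
    · exact h𝔉d c.1 c.2 e x hx (by rw [hxy, ← h, Sym2.eq_swap])
  intro x hx
  have key : ∀ t, (t = r ∨ t = s) → Conn ends (OneColourSwitch.compl ω') t x →
      x ∈ {z | z = r ∨ z = s ∨ z ∈ Sw} := by
    intro t ht hc
    refine mem_of_conn_of_closed ?_ (by rcases ht with rfl | rfl <;> simp) hc
    rintro a ha b hab
    obtain ⟨hne, e, he, hends⟩ := openGraph_adj.1 hab
    simp only [Set.mem_setOf_eq] at ha ⊢
    have he' : ω' e = false := by
      simp only [OneColourSwitch.compl, Bool.not_eq_true'] at he; exact he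
    by_cases hbSw : b ∈ Sw
    · exact Or.inr (Or.inr hbSw)
    rcases ha with ha | ha | haSw
    · -- from `r`
      subst ha
      by_cases hbrs : b = a ∨ b = s
      · rcases hbrs with hb | hb
        · exact (hne hb.symm).elim
        · exfalso
          have : e ∈ within ends ({a, s} : Set V) := ⟨a, by simp, b, by simp [hb], hends⟩
          rw [hrs] at this; exact this
      have hbd : b ≠ d := by rintro rfl; exact (hT e).1 (by rw [hends, Sym2.eq_swap])
      have hde : d ∉ ends e := notMem_of_ends_ne hends hdr.symm hbd
      -- the edge is fixed: `ρ e = W`, so `b ∈ M₂(G − d) = {r, s}`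
      have hfix : ω' e = ρ e := by
        have hnt : e ∉ touches (endsD ends d) Sw := by
          rintro ⟨z, hz, w, hzw⟩
          rw [endsD_of_notMem hde, hends, Sym2.eq_iff] at hzw
          rcases hzw with ⟨h1, _⟩ | ⟨_, h1⟩
          · exact (by rintro ⟨c, _, hr⟩; exact h𝔉r c.1 c.2 hr : a ∉ Sw) (h1 ▸ hz)
          · exact hbSw (h1 ▸ hz)
        have hnR : e ∉ R := fun h => (hR e).1 h ⟨a, Or.inl (Or.inr (r_mem_K2 a s ρ)), b, hends⟩
        exact prod_eq_fixed S hnR hnt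
      rw [hfix] at he'
      have hbM : b ∈ M2 (endsD ends d) a s ρ :=
        mem_M2_of_closed (r_mem_M2 a s ρ) he' (by rw [endsD_of_notMem hde, hends])
      rcases hB b hbM with hb | hb
      · exact (hbrs (Or.inl hb)).elim
      · exact (hbrs (Or.inr hb)).elim
    · -- from `s`
      subst ha
      by_cases hbrs : b = r ∨ b = a
      · rcases hbrs with hb | hb
        · exfalso
          have : e ∈ within ends ({r, a} : Set V) := ⟨a, by simp, b, by simp [hb], hends⟩
          rw [hrs] at this; exact this
        · exact (hne hb.symm).elim
      have hbd : b ≠ d := by rintro rfl; exact (hT e).2 (by rw [hends, Sym2.eq_swap])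
      have hde : d ∉ ends e := notMem_of_ends_ne hends hds.symm hbd
      have hfix : ω' e = ρ e := by
        have hnt : e ∉ touches (endsD ends d) Sw := by
          rintro ⟨z, hz, w, hzw⟩
          rw [endsD_of_notMem hde, hends, Sym2.eq_iff] at hzw
          rcases hzw with ⟨h1, _⟩ | ⟨_, h1⟩
          · exact (by rintro ⟨c, _, hs⟩; exact h𝔉s c.1 c.2 hs : a ∉ Sw) (h1 ▸ hz)
          · exact hbSw (h1 ▸ hz)
        have hnR : e ∉ R := fun h => (hR e).1 h ⟨a, Or.inl (Or.inr (s_mem_K2 r a ρ)), b, hends⟩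
        exact prod_eq_fixed S hnR hnt
      rw [hfix] at he'
      have hbM : b ∈ M2 (endsD ends d) r a ρ :=
        mem_M2_of_closed (s_mem_M2 r a ρ) he' (by rw [endsD_of_notMem hde, hends])
      rcases hB b hbM with hb | hb
      · exact (hbrs (Or.inl hb)).elim
      · exact (hbrs (Or.inr hb)).elim
    · -- from a switched vertex: the edge is flipped, so it is `Y` at `ρ`; `b` is `r`, `s`, or
      -- a sided vertex adjacent to the block, hence in the block
      have hde : d ∉ ends e := hnot_d e a b hends haSw
      have haK : a ∈ K2 (endsD ends d) r s ρ := hSwK haSw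
      have hnR : e ∉ R := fun h => (hR e).1 h ⟨a, Or.inl (Or.inr haK), b, hends⟩
      have ht : e ∈ touches (endsD ends d) Sw := ⟨a, haSw, b, by rw [endsD_of_notMem hde, hends]⟩
      have hflip : ω' e = !ρ e := prod_eq_of_touches S hnR ht
      rw [hflip] at he'
      have hρe : ρ e = true := by
        cases h : ρ e
        · rw [h] at he'; exact absurd he' (by decide)
        · rfl
      have hbK : b ∈ K2 (endsD ends d) r s ρ :=
        mem_K2_of_open haK hρe (by rw [endsD_of_notMem hde, hends])
      by_cases hbr : b = r
      · exact Or.inl hbr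
      by_cases hbs : b = s
      · exact Or.inr (Or.inl hbs)
      exfalso
      have hbS : b ∈ sided (endsD ends d) r s ρ := ⟨Or.inl hbK, hbr, hbs⟩
      exact hbSw (closedIn_switched h𝔉cl S e a b (by rw [endsD_of_notMem hde, hends]) haSw hbS)
  rcases mem_M2_iff.1 hx with hc | hc
  · exact key r (Or.inl rfl) hc
  · exact key s (Or.inr rfl) hc

include hdr hds hrs hT hsep hD hB hR h𝔉K h𝔉r h𝔉s h𝔉cl h𝔉d h𝔉pk in
/-- **The `Y`-world of `{r, s}` at `φ S` lies in `Z(S) = (K₂(G − d) ∖ switched) ∪ {d} ∪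
(C_Y(d; ρ) ∖ (K₂ ∪ M₂)(G − d))`**: the edges inside `Z(S)` are fixed, the root edges of the
switched blocks are `W`, and every edge leaving `Z(S)` to the outside is `W` at `ρ` and fixed. -/
lemma K2_prod_subset :
    K2 ends r s (flipTouch (endsD ends d)
      {x : V | ∃ c : {C // C ∈ 𝔉}, Sum.inl c ∈ S ∧ x ∈ c.1}
      (fun e => if h : e ∈ R then decide (Sum.inr ⟨e, h⟩ ∈ S) else ρ e)) ⊆
      {x : V | (x ∈ K2 (endsD ends d) r s ρ ∧ ¬ ∃ c : {C // C ∈ 𝔉}, Sum.inl c ∈ S ∧ x ∈ c.1) ∨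
        x = d ∨ (x ∈ cluster ends ρ d ∧ x ∉ K2 (endsD ends d) r s ρ ∧
          x ∉ M2 (endsD ends d) r s ρ)} := by
  set Sw := {x : V | ∃ c : {C // C ∈ 𝔉}, Sum.inl c ∈ S ∧ x ∈ c.1} with hSw
  set ω' := flipTouch (endsD ends d) Sw
    (fun e => if h : e ∈ R then decide (Sum.inr ⟨e, h⟩ ∈ S) else ρ e) with hω'
  have hSwK := switched_subset_K2 (ρ := ρ) (r := r) (s := s) (d := d) (R := R) h𝔉K S
  have hSwr : r ∉ Sw := by rintro ⟨c, _, hr⟩; exact h𝔉r c.1 c.2 hr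
  have hSws : s ∉ Sw := by rintro ⟨c, _, hs⟩; exact h𝔉s c.1 c.2 hs
  -- an edge at `d` touches no switched vertex
  have hd_nt : ∀ e, d ∈ ends e → e ∉ touches (endsD ends d) Sw := by
    intro e hde ⟨z, hz, w, hzw⟩
    rw [endsD_of_mem hde, Sym2.eq_iff] at hzw
    have hzd : z = d := by rcases hzw with ⟨h, _⟩ | ⟨_, h⟩ <;> exact h.symm
    exact not_mem_K2_endsD hdr hds ρ (hzd ▸ hSwK hz)
  intro x hx
  have key : ∀ t, (t = r ∨ t = s) → Conn ends ω' t x →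
      x ∈ {z | (z ∈ K2 (endsD ends d) r s ρ ∧ z ∉ Sw) ∨ z = d ∨
        (z ∈ cluster ends ρ d ∧ z ∉ K2 (endsD ends d) r s ρ ∧ z ∉ M2 (endsD ends d) r s ρ)} := by
    intro t ht hc
    refine mem_of_conn_of_closed ?_ (by
      rcases ht with rfl | rfl
      · exact Or.inl ⟨r_mem_K2 t s ρ, hSwr⟩
      · exact Or.inl ⟨s_mem_K2 r t ρ, hSws⟩) hc
    rintro a ha b hab
    obtain ⟨hne, e, he, hends⟩ := openGraph_adj.1 hab
    simp only [Set.mem_setOf_eq] at ha ⊢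
    rcases ha with ⟨haK, haSw⟩ | had | ⟨haC, haK, haM⟩
    · -- from a `Y`-side unswitched vertex (or `r`, `s`)
      have had : a ≠ d := by rintro rfl; exact not_mem_K2_endsD hdr hds ρ haK
      by_cases hbd : b = d
      · exact Or.inr (Or.inl hbd)
      have hde : d ∉ ends e := notMem_of_ends_ne hends had hbd
      have hnR : e ∉ R := fun h => (hR e).1 h ⟨a, Or.inl (Or.inr haK), b, hends⟩
      by_cases hbSw : b ∈ Sw
      · -- into a switched block: the edge is flipped, so `W` at `ρ`… contradiction
        exfalso
        have ht : e ∈ touches (endsD ends d) Sw :=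
          ⟨b, hbSw, a, by rw [endsD_of_notMem hde, hends, Sym2.eq_swap]⟩
        have hflip : ω' e = !ρ e := prod_eq_of_touches S hnR ht
        rw [hflip] at he
        have hρe : ρ e = false := by
          cases h : ρ e
          · rfl
          · rw [h] at he; exact absurd he (by decide)
        by_cases hars : a = r ∨ a = s
        · -- a `W` root edge into a `Y`-side vertex of `G − d`: doubly reached in `G − d`
          have hbK : b ∈ K2 (endsD ends d) r s ρ := hSwK hbSw
          have haM : a ∈ M2 (endsD ends d) r s ρ := by
            rcases hars with rfl | rfl
            · exact r_mem_M2 a s ρ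
            · exact s_mem_M2 r a ρ
          have hbM : b ∈ M2 (endsD ends d) r s ρ :=
            mem_M2_of_closed haM hρe (by rw [endsD_of_notMem hde, hends])
          rcases hB b hbM with hb | hb
          · exact hSwr (hb ▸ hbSw)
          · exact hSws (hb ▸ hbSw)
        · -- `a` sided and adjacent to the switched block: it is in the block
          have haS : a ∈ sided (endsD ends d) r s ρ :=
            ⟨Or.inl haK, fun h => hars (Or.inl h), fun h => hars (Or.inr h)⟩
          exact haSw (closedIn_switched h𝔉cl S e b a
            (by rw [endsD_of_notMem hde, hends, Sym2.eq_swap]) hbSw haS)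
      · -- the edge is fixed and `Y` at `ρ`: `b` is `Y`-side in `G − d`
        have hnt : e ∉ touches (endsD ends d) Sw := by
          rintro ⟨z, hz, w, hzw⟩
          rw [endsD_of_notMem hde, hends, Sym2.eq_iff] at hzw
          rcases hzw with ⟨h1, _⟩ | ⟨_, h1⟩
          · exact haSw (h1 ▸ hz)
          · exact hbSw (h1 ▸ hz)
        have hfix : ω' e = ρ e := prod_eq_fixed S hnR hnt
        rw [hfix] at he
        exact Or.inl ⟨mem_K2_of_open haK he (by rw [endsD_of_notMem hde, hends]), hbSw⟩
    · -- from `d`: a `Y` edge at `ρ` (fixed) into the cluster of `d`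
      subst a
      have hnt : e ∉ touches (endsD ends d) Sw := hd_nt e (by rw [hends]; exact Sym2.mem_mk_left _ _)
      have hnR : e ∉ R := fun h => (hR e).1 h
        ⟨d, Or.inl (Or.inl (mem_cluster_self ends ρ d)), b, hends⟩
      have hfix : ω' e = ρ e := prod_eq_fixed S hnR hnt
      rw [hfix] at he
      have hbC : b ∈ cluster ends ρ d := conn_of_openAdj ⟨e, he, hends⟩
      by_cases hbK : b ∈ K2 (endsD ends d) r s ρ
      · refine Or.inl ⟨hbK, ?_⟩
        rintro ⟨c, _, hb⟩
        exact h𝔉d c.1 c.2 e b hb hends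
      by_cases hbd : b = d
      · exact Or.inr (Or.inl hbd)
      refine Or.inr (Or.inr ⟨hbC, hbK, ?_⟩)
      intro hbM
      rcases hB b hbM with hb | hb
      · exact hbK (by rw [hb]; exact r_mem_K2 r s ρ)
      · exact hbK (by rw [hb]; exact s_mem_K2 r s ρ)
    · -- from a vertex of the cluster of `d` outside the worlds of `G − d` (`d` itself or a
      -- pocket vertex): its edges are fixed and touch no switched block
      have hnt : e ∉ touches (endsD ends d) Sw := by
        by_cases had : a = d
        · subst a
          exact hd_nt e (by rw [hends]; exact Sym2.mem_mk_left _ _)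
        · rintro ⟨z, hz, w, hzw⟩
          have hzK : z ∈ K2 (endsD ends d) r s ρ := hSwK hz
          have hzd : z ≠ d := by rintro rfl; exact not_mem_K2_endsD hdr hds ρ hzK
          have hde : d ∉ ends e := by
            intro hde
            rw [endsD_of_mem hde, Sym2.eq_iff] at hzw
            rcases hzw with ⟨h1, _⟩ | ⟨_, h1⟩ <;> exact hzd h1.symm
          rw [endsD_of_notMem hde, hends, Sym2.eq_iff] at hzw
          -- `z ∈ Sw` is an endpoint; the other endpoint is `a ∈ C_Y(d)`: then `a` is in the
          -- block or is `r, s` — impossible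
          obtain ⟨c, hcS, hzc⟩ := hz
          rcases hzw with ⟨h1, h2⟩ | ⟨h1, h2⟩
          · -- `z = a`: `a` would be sided
            exact haK (h1 ▸ hzK)
          · -- `z = b`, `a = w`: the edge from `z ∈ c` to `a ∈ C_Y(d)`
            have := h𝔉pk c.1 c.2 e z a (by rw [hends, h2, Sym2.eq_swap]) hzc haC
            rcases this with h | h | h
            · exact haK (hSwK ⟨c, hcS, h⟩)
            · exact haK (by rw [h]; exact r_mem_K2 r s ρ)
            · exact haK (by rw [h]; exact s_mem_K2 r s ρ)
      have hnR : e ∉ R := fun h => (hR e).1 h ⟨a, Or.inl (Or.inl haC), b, hends⟩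
      have hfix : ω' e = ρ e := prod_eq_fixed S hnR hnt
      rw [hfix] at he
      have hbC : b ∈ cluster ends ρ d := conn_trans haC (conn_of_openAdj ⟨e, he, hends⟩)
      have hbSw : b ∉ Sw := by
        intro hb
        exact hnt ⟨b, hb, a, by
          have hbd : b ≠ d := by rintro rfl; exact not_mem_K2_endsD hdr hds ρ (hSwK hb)
          have had : a ≠ d := by
            rintro rfl
            exact h𝔉d _ (hb.choose.2) e b (hb.choose_spec.2) hends
          rw [endsD_of_notMem (notMem_of_ends_ne hends had hbd), hends, Sym2.eq_swap]⟩
      by_cases hbK : b ∈ K2 (endsD ends d) r s ρ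
      · exact Or.inl ⟨hbK, hbSw⟩
      by_cases hbd : b = d
      · exact Or.inr (Or.inl hbd)
      refine Or.inr (Or.inr ⟨hbC, hbK, ?_⟩)
      intro hbM
      rcases hB b hbM with hb | hb
      · exact hbK (by rw [hb]; exact r_mem_K2 r s ρ)
      · exact hbK (by rw [hb]; exact s_mem_K2 r s ρ)
  rcases mem_K2_iff.1 hx with hc | hc
  · exact key r (Or.inl rfl) hc
  · exact key s (Or.inr rfl) hc

include hdr hds hrs hT hsep hD hK hB hR h𝔉K h𝔉r h𝔉s h𝔉cl h𝔉d h𝔉pk in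
/-- **Every point of the product fibre is `Sep`** (for `p, q ≠ d`). -/
lemma sep2_prod (hp : p ≠ d) (hq : q ≠ d) :
    sep2 ends p q r s (flipTouch (endsD ends d)
      {x : V | ∃ c : {C // C ∈ 𝔉}, Sum.inl c ∈ S ∧ x ∈ c.1}
      (fun e => if h : e ∈ R then decide (Sum.inr ⟨e, h⟩ ∈ S) else ρ e)) := by
  have hK2 := K2_prod_subset hdr hds hrs hT hsep hD hB hR h𝔉K h𝔉r h𝔉s h𝔉cl h𝔉d h𝔉pk S
  have hM2 := M2_prod_subset hdr hds hrs hT hsep hB hR h𝔉K h𝔉r h𝔉s h𝔉cl h𝔉d S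
  have hSwK := switched_subset_K2 (ρ := ρ) (r := r) (s := s) (d := d) (R := R) h𝔉K S
  have hsepD := sep2_endsD_of_sep2 (d := d) hsep
  obtain ⟨⟨hpK, hqK⟩, _⟩ := sep2_iff.1 hsepD
  obtain ⟨⟨hpK', hqK'⟩, ⟨hpM', hqM'⟩⟩ := sep2_iff.1 hsep
  -- `p, q` are not in the cluster of `d` (it lies in the `Y`-world of `G`)
  have hcl : ∀ x, x ∈ cluster ends ρ d → x ∈ K2 ends r s ρ := by
    intro x hx
    rcases mem_K2_iff.1 hK with hc | hc
    · exact mem_K2_iff.2 (Or.inl (conn_trans hc hx))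
    · exact mem_K2_iff.2 (Or.inr (conn_trans hc hx))
  have hpr : p ≠ r := by rintro rfl; exact hpM' (r_mem_M2 p s ρ)
  have hps : p ≠ s := by rintro rfl; exact hpM' (s_mem_M2 r p ρ)
  have hqr : q ≠ r := by rintro rfl; exact hqM' (r_mem_M2 q s ρ)
  have hqs : q ≠ s := by rintro rfl; exact hqM' (s_mem_M2 r q ρ)
  rw [sep2_iff]
  refine ⟨⟨fun h => ?_, fun h => ?_⟩, ⟨fun h => ?_, fun h => ?_⟩⟩
  · rcases hK2 h with ⟨h', _⟩ | h' | ⟨h', _, _⟩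
    · exact hpK h'
    · exact hp h'
    · exact hpK' (hcl p h')
  · rcases hK2 h with ⟨h', _⟩ | h' | ⟨h', _, _⟩
    · exact hqK h'
    · exact hq h'
    · exact hqK' (hcl q h')
  · rcases hM2 h with h' | h' | h'
    · exact hpr h'
    · exact hps h'
    · exact hpK (hSwK h')
  · rcases hM2 h with h' | h' | h'
    · exact hqr h'
    · exact hqs h'
    · exact hqK (hSwK h')

include hdr hds hrs hT hsep hD hB hR h𝔉K h𝔉r h𝔉s h𝔉cl h𝔉d h𝔉pk in
/-- **Every point of the product fibre is `DOne`.** -/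
lemma DOne_prod :
    DOne ends r s d (flipTouch (endsD ends d)
      {x : V | ∃ c : {C // C ∈ 𝔉}, Sum.inl c ∈ S ∧ x ∈ c.1}
      (fun e => if h : e ∈ R then decide (Sum.inr ⟨e, h⟩ ∈ S) else ρ e)) := by
  have hK2 := K2_prod_subset hdr hds hrs hT hsep hD hB hR h𝔉K h𝔉r h𝔉s h𝔉cl h𝔉d h𝔉pk S
  have hM2 := M2_prod_subset hdr hds hrs hT hsep hB hR h𝔉K h𝔉r h𝔉s h𝔉cl h𝔉d S
  have hSwK := switched_subset_K2 (ρ := ρ) (r := r) (s := s) (d := d) (R := R) h𝔉K S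
  intro x hxr hxs hxd hxK hxM
  rcases hM2 hxM with h | h | hSw
  · exact hxr h
  · exact hxs h
  rcases hK2 hxK with ⟨_, h'⟩ | h' | ⟨_, h', _⟩
  · exact h' hSw
  · exact hxd h'
  · exact h' (hSwK hSw)

end Worlds

end NoPocket

end Summit.Ventures.PercRepro2
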